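import Mathlib
import HarnessLib
import Summits.ValiantsHypothesis.ValiantsHypothesis.Theorems.MonotoneRestorationOrbitRestorationQPSmlPowerSums
import Summits.ValiantsHypothesis.ValiantsHypothesis.Theorems.MonotoneRestorationOrbitRestorationQPSmlDeltaCalculus
import Summits.ValiantsHypothesis.ValiantsHypothesis.Theorems.MonotoneRestorationOrbitRestorationQPSmlPeeling

/-!
# The narrowness lemma: symmetric forms killed by `j` difference derivatives are `(j-1)`-narrow
(crux `OrbitRestorationQP`, stmt-ValiantsHypothesis-18293 — lane SML: the column-set-multilinear `ΣΠΣ` stratum of A_∞)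

Write `Δ_{a,b} = Π_{i<j} (∂_{a i} - ∂_{b i})` (`2j` distinct variables; def-free `List.foldl`, see
`…SmlDeltaCalculus`) and `p_μ = Π_{k∈μ} p_k`.  Main results (blueprint `SML-STRATUM-BLUEPRINT.md`):

* **(N2)** `deltaFold_psumProd_linearIndependent`: in `N ≥ d` variables the family
  `{Δ_{a,b} p_μ : μ ⊢ d with at least j parts ≥ 2}` (distinct `μ`) is linearly independent.  Proof by PEELING
  (`…SmlPeeling`): transport the pair system so that pair `0` is the variables `(0,1)` and the others are shifted by
  two; the functional `q ↦ coeff_{m₀}` of `q(y_0 := t, y_1 := 0)` commutes with the shifted derivatives, and on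
  `(∂_0-∂_1) p_μ = Σ_k k (y_0^{k-1}-y_1^{k-1}) p_{μ∖k}` its value at the least exponent `m₀` in play isolates
  `p_{μ∖(m₀+1)}` — induction on `j`, base case = `SmlPowerSums.psumProd_linearIndependent`.
* **NARROWNESS THEOREM** `narrow_of_deltaFold_eq_zero`: a symmetric homogeneous `p` of degree `d ≤ N` with
  `Δ_{a,b} p = 0` is a `ℂ`-combination of the `p_μ` over multisets `μ` (positive parts, sum `d`) having FEWER THAN
  `j` parts `≥ 2`.  (With the Johnson rank lemma this gives: low flattening rank ⇒ narrow.)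
[folklore]
-/

set_option linter.dupNamespace false

namespace Summit.ValiantsHypothesis.ValiantsHypothesis.Theorems.SmlDeltaNarrow

open MvPolynomial SmlPowerSums SmlDeltaCalculus SmlPeeling

/-! ### (N2) Linear independence of the difference derivatives of wide power-sum products -/

/-- Regrouping a finite indexed combination by the values of the index map (fibrewise sums of coefficients).
[folklore] -/
theorem sum_smul_regroup {V : Type*} [AddCommGroup V] [Module ℂ V] {m : ℕ} (I : Finset (Fin m))
    (μ : Fin m → Multiset ℕ) (c : Fin m → ℂ) (F : Multiset ℕ → V) :
    ∑ i ∈ I, c i • F (μ i) =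
      ∑ ν ∈ I.image μ, (∑ i ∈ I.filter (fun i => μ i = ν), c i) • F ν := by
  rw [← Finset.sum_fiberwise_of_maps_to (g := μ) (t := I.image μ) (fun i hi => Finset.mem_image_of_mem μ hi)]
  refine Finset.sum_congr rfl fun ν _ => ?_
  rw [Finset.sum_smul]
  refine Finset.sum_congr rfl fun i hi => ?_
  rw [(Finset.mem_filter.1 hi).2]

/-- **(N2)** For a system of `j` disjoint pairs of distinct variables among `N ≥ d` variables, the polynomials
`Π_i (∂_{a i} - ∂_{b i}) (Π_{k∈μ} p_k)`, over DISTINCT multisets `μ` of positive integers with `μ.sum = d` and at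
least `j` parts `≥ 2`, are linearly independent over `ℂ`. [folklore] -/
theorem deltaFold_psumProd_linearIndependent :
    ∀ (j N d : ℕ) (a b : Fin j → Fin N), Function.Injective a → Function.Injective b →
      (∀ i i', a i ≠ b i') → d ≤ N → ∀ (S : Finset (Multiset ℕ)) (c : Multiset ℕ → ℂ),
      (∀ μ ∈ S, (∀ k ∈ μ, 0 < k) ∧ μ.sum = d ∧ j ≤ (μ.filter fun k => 2 ≤ k).card) →
      ∑ μ ∈ S, c μ • List.foldl (fun (q : MvPolynomial (Fin N) ℂ) i => pderiv (a i) q - pderiv (b i) q)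
        ((μ.map (psum (Fin N) ℂ)).prod) (List.finRange j) = 0 →
      ∀ μ ∈ S, c μ = 0 := by
  intro j
  induction j with
  | zero =>
    intro N d a b _ _ _ hdN S c hS hrel
    simp only [List.finRange_zero, List.foldl_nil] at hrel
    exact psumProd_linearIndependent d N hdN S c (fun μ hμ => ⟨(hS μ hμ).1, (hS μ hμ).2.1⟩) hrel
  | succ j ih =>
    intro N d a b ha hb hab hdN S c hS hrel
    by_contra hne
    simp only [not_forall] at hne
    obtain ⟨μ₀, hμ₀S, hμ₀⟩ := hne
    -- two of the variables are `a 0 ≠ b 0`, so `N = N' + 2`; moreover `2j ≤ N'`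
    have hcard : 2 * (j + 1) ≤ N := by
      have h := Fintype.card_le_of_injective _ (Sum.elim_injective.2 ⟨ha, hb, hab⟩)
      simp only [Fintype.card_sum, Fintype.card_fin] at h
      omega
    obtain ⟨N', rfl⟩ : ∃ N', N = N' + 2 := ⟨N - 2, by omega⟩
    -- the canonical-headed target system
    set a' : Fin j → Fin N' := fun i => ⟨2 * (i : ℕ), by omega⟩ with ha'def
    set b' : Fin j → Fin N' := fun i => ⟨2 * (i : ℕ) + 1, by omega⟩ with hb'def
    have ha' : Function.Injective a' := by
      intro i i' h; simp only [ha'def, Fin.mk.injEq] at h; exact Fin.ext (by omega)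
    have hb' : Function.Injective b' := by
      intro i i' h; simp only [hb'def, Fin.mk.injEq] at h; exact Fin.ext (by omega)
    have hab' : ∀ i i', a' i ≠ b' i' := by
      intro i i' h; simp only [ha'def, hb'def, Fin.mk.injEq] at h; omega
    set a₁ : Fin (j + 1) → Fin (N' + 2) := Fin.cons 0 fun i => (a' i).succ.succ with ha₁def
    set b₁ : Fin (j + 1) → Fin (N' + 2) := Fin.cons 1 fun i => (b' i).succ.succ with hb₁def
    have hsucc2_inj : Function.Injective fun x : Fin N' => x.succ.succ :=
      (Fin.succ_injective _).comp (Fin.succ_injective _)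
    have ha₁ : Function.Injective a₁ := by
      refine Fin.cons_injective_of_injective ?_ (hsucc2_inj.comp ha')
      rintro ⟨i, hi⟩; exact Fin.succ_ne_zero _ hi
    have hb₁ : Function.Injective b₁ := by
      refine Fin.cons_injective_of_injective ?_ (hsucc2_inj.comp hb')
      rintro ⟨i, hi⟩
      have h1 : (1 : Fin (N' + 2)) = (0 : Fin (N' + 1)).succ := rfl
      rw [h1, Fin.succ_inj] at hi
      exact Fin.succ_ne_zero _ hi
    have hab₁ : ∀ i i', a₁ i ≠ b₁ i' := by
      intro i i'
      refine Fin.cases ?_ (fun i => ?_) i <;> refine Fin.cases ?_ (fun i' => ?_) i'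
      · simp [ha₁def, hb₁def]
      · simp only [ha₁def, hb₁def, Fin.cons_zero, Fin.cons_succ]
        exact (Fin.succ_ne_zero _).symm
      · simp only [ha₁def, hb₁def, Fin.cons_zero, Fin.cons_succ]
        have h1 : (1 : Fin (N' + 2)) = (0 : Fin (N' + 1)).succ := rfl
        rw [h1, Ne, Fin.succ_inj]
        exact Fin.succ_ne_zero _
      · simp only [ha₁def, hb₁def, Fin.cons_succ, Ne, Fin.succ_inj]
        exact hab' i i'
    -- transport the relation to the target system
    obtain ⟨g, hga, hgb⟩ := exists_perm_conj a b a₁ b₁ ha hb hab ha₁ hb₁ hab₁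
    have hrel₁ : ∑ μ ∈ S, c μ • List.foldl (fun (q : MvPolynomial (Fin (N' + 2)) ℂ) i =>
        pderiv (a₁ i) q - pderiv (b₁ i) q) ((μ.map (psum (Fin (N' + 2)) ℂ)).prod) (List.finRange (j + 1)) = 0 := by
      have h := congrArg (rename g) hrel
      rw [sum_deltaFold_psumProd_rename, map_zero] at h
      simp only [hga, hgb] at h
      exact h
    -- peel pair `0 = (0, 1)`
    have hrel₂ : ∑ μ ∈ S, c μ • List.foldl (fun (q : MvPolynomial (Fin (N' + 2)) ℂ) i =>
        pderiv (a' i).succ.succ q - pderiv (b' i).succ.succ q)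
        (pderiv 0 ((μ.map (psum (Fin (N' + 2)) ℂ)).prod) - pderiv 1 ((μ.map (psum (Fin (N' + 2)) ℂ)).prod))
        (List.finRange j) = 0 := by
      rw [← hrel₁]
      refine Finset.sum_congr rfl fun μ _ => ?_
      rw [deltaFold_succ]
      simp [ha₁def, hb₁def]
    -- the least part `≥ 2` in play
    set T : Finset (Multiset ℕ) := S.filter fun μ => c μ ≠ 0 with hTdef
    have hμ₀T : μ₀ ∈ T := Finset.mem_filter.2 ⟨hμ₀S, hμ₀⟩
    set bigparts : Finset ℕ := T.biUnion fun μ => (μ.filter fun k => 2 ≤ k).toFinset with hbigparts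
    have hbig_ne : bigparts.Nonempty := by
      have hcardμ₀ : j + 1 ≤ (μ₀.filter fun k => 2 ≤ k).card := (hS μ₀ hμ₀S).2.2
      obtain ⟨k, hk⟩ := Multiset.card_pos_iff_exists_mem.1 (by omega : 0 < (μ₀.filter fun k => 2 ≤ k).card)
      exact ⟨k, Finset.mem_biUnion.2 ⟨μ₀, hμ₀T, Multiset.mem_toFinset.2 hk⟩⟩
    set k₀ : ℕ := bigparts.min' hbig_ne with hk₀def
    have hk₀mem : k₀ ∈ bigparts := by rw [hk₀def]; exact Finset.min'_mem bigparts hbig_ne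
    obtain ⟨μ₁, hμ₁T, hk₀μ₁'⟩ := Finset.mem_biUnion.1 hk₀mem
    rw [Multiset.mem_toFinset, Multiset.mem_filter] at hk₀μ₁'
    obtain ⟨hk₀μ₁, hk₀2⟩ := hk₀μ₁'
    have hμ₁S : μ₁ ∈ S := (Finset.mem_filter.1 hμ₁T).1
    have hcμ₁ : c μ₁ ≠ 0 := (Finset.mem_filter.1 hμ₁T).2
    have hk₀le : ∀ μ ∈ T, ∀ k ∈ μ, 2 ≤ k → k₀ ≤ k := by
      intro μ hμ k hk hk2
      have hkf : k ∈ (μ.filter fun k => 2 ≤ k).toFinset :=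
        Multiset.mem_toFinset.2 (Multiset.mem_filter.2 ⟨hk, hk2⟩)
      have hmem : k ∈ bigparts := by
        rw [hbigparts, Finset.mem_biUnion]
        exact ⟨μ, hμ, hkf⟩
      rw [hk₀def]
      exact Finset.min'_le bigparts k hmem
    have hk₀d : k₀ ≤ d := by
      have := Multiset.le_sum_of_mem hk₀μ₁
      rw [(hS μ₁ hμ₁S).2.1] at this
      exact this
    -- restrict to `T` and apply the peeling functional at the exponent `m₀ = k₀ - 1`
    set m₀ : ℕ := k₀ - 1 with hm₀def
    have hm₀pos : 0 < m₀ := by omega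
    have hm₀k : m₀ + 1 = k₀ := by omega
    have hrelT : ∑ μ ∈ T, c μ • List.foldl (fun (q : MvPolynomial (Fin (N' + 2)) ℂ) i =>
        pderiv (a' i).succ.succ q - pderiv (b' i).succ.succ q)
        (pderiv 0 ((μ.map (psum (Fin (N' + 2)) ℂ)).prod) - pderiv 1 ((μ.map (psum (Fin (N' + 2)) ℂ)).prod))
        (List.finRange j) = 0 := by
      rw [hTdef, Finset.sum_filter_of_ne]
      · exact hrel₂
      · intro μ _ h; by_contra hc; rw [hc, zero_smul] at h; exact h rfl
    have hpeeled := congrArg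
      (fun q : MvPolynomial (Fin (N' + 2)) ℂ => ((finSuccEquiv ℂ N') (((finSuccEquiv ℂ (N' + 1)) q).coeff m₀)).coeff 0)
      hrelT
    simp only [map_zero, Polynomial.coeff_zero] at hpeeled
    rw [peel_sum] at hpeeled
    have hterm : ∀ μ ∈ T, ((finSuccEquiv ℂ N') (((finSuccEquiv ℂ (N' + 1))
        (c μ • List.foldl (fun (q : MvPolynomial (Fin (N' + 2)) ℂ) i =>
          pderiv (a' i).succ.succ q - pderiv (b' i).succ.succ q)
          (pderiv 0 ((μ.map (psum (Fin (N' + 2)) ℂ)).prod) - pderiv 1 ((μ.map (psum (Fin (N' + 2)) ℂ)).prod))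
          (List.finRange j))).coeff m₀)).coeff 0 =
        (c μ * ((μ.count k₀ : ℂ) * (m₀ + 1 : ℂ))) • List.foldl (fun (q : MvPolynomial (Fin N') ℂ) i =>
          pderiv (a' i) q - pderiv (b' i) q) (((μ.erase k₀).map (psum (Fin N') ℂ)).prod) (List.finRange j) := by
      intro μ hμ
      have hμS : μ ∈ S := (Finset.mem_filter.1 hμ).1
      rw [peel_smul, peel_deltaFoldList, peel_delta_psumProd μ (hS μ hμS).1 m₀ hm₀pos
        (fun k hk hk2 => hm₀k ▸ hk₀le μ hμ k hk hk2), deltaFoldList_smul, ← mul_smul, hm₀k]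
    rw [Finset.sum_congr rfl hterm] at hpeeled
    -- only multisets containing `k₀` survive; re-index them by `μ ↦ μ.erase k₀`
    set T₁ : Finset (Multiset ℕ) := T.filter fun μ => k₀ ∈ μ with hT₁def
    have hsum₁ : ∑ μ ∈ T₁, (c μ * ((μ.count k₀ : ℂ) * (m₀ + 1 : ℂ))) •
        List.foldl (fun (q : MvPolynomial (Fin N') ℂ) i => pderiv (a' i) q - pderiv (b' i) q)
          (((μ.erase k₀).map (psum (Fin N') ℂ)).prod) (List.finRange j) = 0 := by
      rw [hT₁def, Finset.sum_filter_of_ne]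
      · exact hpeeled
      · intro μ _ h
        by_contra hk
        rw [Multiset.count_eq_zero_of_notMem hk, Nat.cast_zero, zero_mul, mul_zero, zero_smul] at h
        exact h rfl
    have hinj : Set.InjOn (fun μ : Multiset ℕ => μ.erase k₀) T₁ := by
      intro μ hμ μ' hμ' h
      have hk : k₀ ∈ μ := (Finset.mem_filter.1 hμ).2
      have hk' : k₀ ∈ μ' := (Finset.mem_filter.1 hμ').2
      simp only at h
      rw [← Multiset.cons_erase hk, ← Multiset.cons_erase hk', h]
    set U : Finset (Multiset ℕ) := T₁.image fun μ => μ.erase k₀ with hUdef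
    set c' : Multiset ℕ → ℂ := fun ν => c (k₀ ::ₘ ν) * (((k₀ ::ₘ ν).count k₀ : ℂ) * (m₀ + 1 : ℂ)) with hc'def
    have hU : ∀ ν ∈ U, (∀ k ∈ ν, 0 < k) ∧ ν.sum = d - k₀ ∧ j ≤ (ν.filter fun k => 2 ≤ k).card := by
      intro ν hν
      obtain ⟨μ, hμ, rfl⟩ := Finset.mem_image.1 hν
      have hμS : μ ∈ S := (Finset.mem_filter.1 (Finset.mem_filter.1 hμ).1).1
      have hk : k₀ ∈ μ := (Finset.mem_filter.1 hμ).2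
      obtain ⟨hpos, hsum, hcardμ⟩ := hS μ hμS
      refine ⟨fun k hk' => hpos k (Multiset.mem_of_mem_erase hk'), ?_, ?_⟩
      · rw [← Multiset.cons_erase hk, Multiset.sum_cons] at hsum
        omega
      · have h := Multiset.filter_cons_of_pos (p := fun k => 2 ≤ k) (μ.erase k₀) (a := k₀) hk₀2
        rw [Multiset.cons_erase hk] at h
        rw [h, Multiset.card_cons] at hcardμ
        omega
    have hsumU : ∑ ν ∈ U, c' ν • List.foldl (fun (q : MvPolynomial (Fin N') ℂ) i =>
        pderiv (a' i) q - pderiv (b' i) q) ((ν.map (psum (Fin N') ℂ)).prod) (List.finRange j) = 0 := by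
      rw [hUdef, Finset.sum_image hinj, ← hsum₁]
      refine Finset.sum_congr rfl fun μ hμ => ?_
      have hk : k₀ ∈ μ := (Finset.mem_filter.1 hμ).2
      simp only [hc'def, Multiset.cons_erase hk]
    have hzero := ih N' (d - k₀) a' b' ha' hb' hab' (by omega) U c' hU hsumU
    -- contradiction at `μ₁`
    have hμ₁T₁ : μ₁ ∈ T₁ := Finset.mem_filter.2 ⟨hμ₁T, hk₀μ₁⟩
    have h := hzero (μ₁.erase k₀) (Finset.mem_image.2 ⟨μ₁, hμ₁T₁, rfl⟩)
    simp only [hc'def, Multiset.cons_erase hk₀μ₁, mul_eq_zero, Nat.cast_eq_zero] at h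
    rcases h with h | h | h
    · exact hcμ₁ h
    · exact (Multiset.count_pos.2 hk₀μ₁).ne' h
    · have : (m₀ : ℂ) + 1 ≠ 0 := by exact_mod_cast (Nat.succ_ne_zero m₀)
      exact this h

/-! ### The narrowness theorem -/

/-- **NARROWNESS THEOREM.**  Let `p` be a symmetric polynomial in `N` variables over `ℂ`, homogeneous of degree
`d ≤ N`, and suppose `Π_{i<j} (∂_{a i} - ∂_{b i}) p = 0` for a system of `j` disjoint pairs of distinct variables.
Then `p` is a `ℂ`-combination of power-sum products `Π_{k∈μ} p_k` over multisets `μ` of positive integers with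
`μ.sum = d` and FEWER THAN `j` parts `≥ 2`. [folklore] -/
theorem narrow_of_deltaFold_eq_zero {N d j : ℕ} (hdN : d ≤ N) (a b : Fin j → Fin N)
    (ha : Function.Injective a) (hb : Function.Injective b) (hab : ∀ i i', a i ≠ b i')
    (p : MvPolynomial (Fin N) ℂ) (hs : p.IsSymmetric) (hh : p.IsHomogeneous d)
    (hΔ : List.foldl (fun (q : MvPolynomial (Fin N) ℂ) i => pderiv (a i) q - pderiv (b i) q) p
      (List.finRange j) = 0) :
    ∃ (S : Finset (Multiset ℕ)) (c : Multiset ℕ → ℂ),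
      (∀ μ ∈ S, (∀ k ∈ μ, 0 < k) ∧ μ.sum = d ∧ (μ.filter fun k => 2 ≤ k).card < j) ∧
      p = ∑ μ ∈ S, c μ • (μ.map (psum (Fin N) ℂ)).prod := by
  obtain ⟨m, μ, c, hμ, hp⟩ := exists_psumProd_expansion N d p hs hh
  set Iw : Finset (Fin m) := Finset.univ.filter fun i => j ≤ ((μ i).filter fun k => 2 ≤ k).card with hIw
  set In : Finset (Fin m) := Finset.univ.filter fun i => ¬ j ≤ ((μ i).filter fun k => 2 ≤ k).card with hIn
  have hsplit : p = ∑ i ∈ In, c i • ((μ i).map (psum (Fin N) ℂ)).prod +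
      ∑ i ∈ Iw, c i • ((μ i).map (psum (Fin N) ℂ)).prod := by
    rw [hp, hIn, hIw, ← Finset.sum_filter_add_sum_filter_not Finset.univ
      (fun i => j ≤ ((μ i).filter fun k => 2 ≤ k).card), add_comm]
  -- the wide part is killed by `Δ`, hence vanishes by (N2) after regrouping
  have hwideΔ : ∑ i ∈ Iw, c i • List.foldl (fun (q : MvPolynomial (Fin N) ℂ) i => pderiv (a i) q - pderiv (b i) q)
      (((μ i).map (psum (Fin N) ℂ)).prod) (List.finRange j) = 0 := by
    have h := hΔ
    rw [hsplit, deltaFoldList_add, deltaFoldList_sum, deltaFoldList_sum] at h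
    have hn : ∑ i ∈ In, List.foldl (fun (q : MvPolynomial (Fin N) ℂ) i => pderiv (a i) q - pderiv (b i) q)
        (c i • ((μ i).map (psum (Fin N) ℂ)).prod) (List.finRange j) = 0 := by
      refine Finset.sum_eq_zero fun i hi => ?_
      rw [deltaFoldList_smul, deltaFold_psumProd_eq_zero_of_narrow j a b ha hb hab (μ i) (hμ i).1
        (not_le.1 (Finset.mem_filter.1 hi).2), smul_zero]
    rw [hn, zero_add] at h
    rw [← h]
    exact Finset.sum_congr rfl fun i _ => (deltaFoldList_smul a b _ _ _).symm
  have key := sum_smul_regroup Iw μ c (fun ν => List.foldl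
    (fun (q : MvPolynomial (Fin N) ℂ) i => pderiv (a i) q - pderiv (b i) q) ((ν.map (psum (Fin N) ℂ)).prod)
    (List.finRange j))
  beta_reduce at key
  rw [key] at hwideΔ
  have hS : ∀ ν ∈ Iw.image μ, (∀ k ∈ ν, 0 < k) ∧ ν.sum = d ∧ j ≤ (ν.filter fun k => 2 ≤ k).card := by
    intro ν hν
    obtain ⟨i, hi, rfl⟩ := Finset.mem_image.1 hν
    exact ⟨(hμ i).1, (hμ i).2, (Finset.mem_filter.1 hi).2⟩
  have hzero := deltaFold_psumProd_linearIndependent j N d a b ha hb hab hdN (Iw.image μ) _ hS hwideΔ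
  have hwide : ∑ i ∈ Iw, c i • ((μ i).map (psum (Fin N) ℂ)).prod = 0 := by
    have key' := sum_smul_regroup Iw μ c (fun ν => (ν.map (psum (Fin N) ℂ)).prod)
    beta_reduce at key'
    rw [key']
    exact Finset.sum_eq_zero fun ν hν => by rw [hzero ν hν, zero_smul]
  rw [hwide, add_zero] at hsplit
  -- package the narrow part
  refine ⟨In.image μ, fun ν => ∑ i ∈ In.filter (fun i => μ i = ν), c i, ?_, ?_⟩
  · intro ν hν
    obtain ⟨i, hi, rfl⟩ := Finset.mem_image.1 hν
    exact ⟨(hμ i).1, (hμ i).2, not_le.1 (Finset.mem_filter.1 hi).2⟩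
  · have key' := sum_smul_regroup In μ c (fun ν => (ν.map (psum (Fin N) ℂ)).prod)
    beta_reduce at key'
    rw [hsplit, key']

end Summit.ValiantsHypothesis.ValiantsHypothesis.Theorems.SmlDeltaNarrow
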